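import Mathlib
import HarnessLib
import Summits.HubbardSuperconductivity.HubbardSuperconductivity.Theorems.KLProgrammeKLRegimeTwoVolumeTowerTruncEnd
import Summits.HubbardSuperconductivity.HubbardSuperconductivity.Theorems.KLProgrammeKLRegimeTwoVolumeTowerEndDoor
import Summits.HubbardSuperconductivity.HubbardSuperconductivity.Theorems.KLProgrammeKLRegimeTwoVolumeDefectSupSpine
import Summits.HubbardSuperconductivity.HubbardSuperconductivity.Theorems.KLProgrammeKLRegimeTwoVolumeSourceSmoothAnalysis

/-!
# [«(VL)-SRC-WINDOW» W twin (k3c4-p1 g16, filed by g17 under the pen's (R235) «KEY = WINDOW»): hypothesis on `srcSmooth (klTowerD …)`, conclusion with `klSrcAnalysisAtW`; one extra rewrite `srcSmooth_klTowerD_eq`]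
# Route `KLProgramme` — crux K3, VL child `KLRegimeVolumeLimitV17F2` (stmt-HubbardSuperconductivity-20440), blueprint v5 M5 / W6c-T: THE END OF THE
# SOURCE-TRUNCATED TOWER IN THE SHAPE OF THE DOOR (located «(VL)-SRC-HIGH»; seat hubbard-kl-k3c4-p1 g14; `--supports` 20440)

Twin of `…TwoVolumeTowerEndDoor.tower_end_glued_inner` (p602349) whose input `hend` is the conclusion of
`…TowerTruncEnd.towerTrunc_end_keyedDefect_eventually_le`: the keyed defect of the SOURCE-TRUNCATED read-outs `srcTrunc 3 (klTowerD V … K_V J)` — which is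
literally what k3c5-p3's door `…VolumeLimitV9GluedSrcPairDoorAt.stub_vl_nestedFramed_of_gluedSrcDefect_keyedAt` reads (no truncation to remove).  Output: the
door's inner text, verbatim as in p602349.

* **`towerTrunc_end_glued_inner`**.

Proofs only; no definition.
-/

noncomputable section

namespace Summit.HubbardSuperconductivity.HubbardSuperconductivity.Theorems.TwoVolumeSource

set_option linter.dupNamespace false -- summit = problem name (single-conjunct summit), D-0017

open Finset Filter Topology Literature.MathematicalPhysics.QuantumLattice GrassmannAlgebra Literature.Probability.LatticeModels
  Literature.Probability.LatticeModels.BattleFederbush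
open Summit.HubbardSuperconductivity.HubbardSuperconductivity.Theorems.TwoPointAssembly
open Summit.HubbardSuperconductivity.HubbardSuperconductivity.Theorems.KLRegimeSplit
open Summit.HubbardSuperconductivity.HubbardSuperconductivity.Theorems.KLProgrammeLegKernels
open Summit.HubbardSuperconductivity.HubbardSuperconductivity.Theorems.EngineV8
open Summit.HubbardSuperconductivity.HubbardSuperconductivity.Theorems.TwoVolumeDefect

set_option maxHeartbeats 400000 in -- the instance supremum and the door's text in one declaration
/-- **THE END OF THE TRUNCATED TOWER IN THE SHAPE OF THE DOOR** (see the module docstring). [folklore: bookkeeping; cite: BenfattoGiulianiMastropietro2006, §2.9 (4.3)-(4.6)] -/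
theorem towerTrunc_end_glued_innerW (β U μ : ℝ) (hβ : 0 < β) (Mth : ℕ → ℕ → ℕ) (r : ℕ → ℕ) (hr : Tendsto r atTop atTop)
    (hRd : ∀ L, 0 < L → 2 * (2 * (nScales β + 1) * r L + r L) < L)
    (hend : ∀ (k : ℕ) (η : ℝ), 0 < η → ∀ᶠ L in atTop, ∀ (b M : ℕ) [NeZero L] [NeZero (b * L)] [NeZero M], Mth L b ≤ M →
      ∀ (p : Fin k) (w : SrcLabel (b * L) M (nScales β)),
        (∀ i, 2 * (nScales β + 1) * r L + r L ≤ (w.1.1.2 i).val % L ∧ (w.1.1.2 i).val % L + (2 * (nScales β + 1) * r L + r L) < L) →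
          ∑ X ∈ univ.filter (fun X : Fin k → SrcLabel (b * L) M (nScales β) => X p = w),
              ‖kernel ℂ (srcTrunc ℂ (fun q : SrcLabel (b * L) M (nScales β) => q.2 = 1) 3
                    (srcSmooth (b * L) M (nScales β) (klTowerD (b * L) M β U μ (klFlowFrameU (b * L) M β U μ (nScales β + 1)) (nScales β)))) k X -
                (if ∀ i, (klBlockEquivD L b M (nScales β) (X i)).1 = (klBlockEquivD L b M (nScales β) (X p)).1 then
                  kernel ℂ (srcTrunc ℂ (fun q : SrcLabel L M (nScales β) => q.2 = 1) 3
                      (srcSmooth L M (nScales β) (klTowerD L M β U μ (klFlowFrameU L M β U μ (nScales β + 1)) (nScales β)))) k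
                    (fun i => (klBlockEquivD L b M (nScales β) (X i)).2) else 0)‖ ≤ imagTimeWeight β M * η) :
    ∃ L₀ : ℕ, ∃ δ : ℕ → ℝ, Tendsto δ atTop (𝓝 0) ∧ ∃ Rd : ℕ → ℕ, Tendsto Rd atTop atTop ∧
      ∀ (L : ℕ) [NeZero L], L₀ ≤ L → ∀ (L'' : ℕ) [NeZero L''] (b : ℕ), L'' = b * L → ∃ M₀ : ℕ, ∀ (M : ℕ) [NeZero M], M₀ ≤ M →
        ∃ (J : ℕ) (e : (SpaceTimeIdx L'' M × SectorLeg (sectorCount J)) ≃ (Fin 2 → Fin b) × (SpaceTimeIdx L M × SectorLeg (sectorCount J)))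
          (ed : SrcLabel L'' M J ≃ (Fin 2 → Fin b) × SrcLabel L M J),
          (∀ X' i, ((e X').1 i : ℕ) = (X'.1.2 i).val / L) ∧
          (∀ X', (e X').2 = ((X'.1.1, fun i => (((X'.1.2 i).val : ℕ) : ZMod L)), X'.2)) ∧
          (∀ x s, ed (x, s) = ((e x).1, ((e x).2, s))) ∧
        ∃ of : SpaceTimeIdx L'' M, (∀ j, Rd L ≤ (of.2 j).val % L ∧ (of.2 j).val % L + Rd L < L) ∧
          2 * (imagTimeWeight β M)⁻¹ *
            (∑ X ∈ univ.filter (fun X : Fin 2 → SrcLabel L'' M J => X 0 = ((of, ((⟨0, sectorCount_pos _⟩, 0), 0)), 1) ∧ (X 1).2 = 1),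
              ‖kernel ℂ (srcTrunc ℂ (fun Y : SrcLabel L'' M J => Y.2 = 1) 3
                    (ExteriorAlgebra.map (Matrix.toLin' (((imagTimeWeight β M : ℝ) : ℂ) •
                        klSrcAnalysisAtW L'' M β μ (klFlowFrameU L'' M β U μ (nScales β + 1)) J))
                      (klEffectiveAction L'' M β U μ (klFlowFrameU L'' M β U μ (nScales β + 1)) klE0 (nScales β + 1)))) 2 X -
                  (if ∀ i, (ed (X i)).1 = (ed (X 0)).1 then
                    kernel ℂ (srcTrunc ℂ (fun Y : SrcLabel L M J => Y.2 = 1) 3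
                      (ExteriorAlgebra.map (Matrix.toLin' (((imagTimeWeight β M : ℝ) : ℂ) •
                          klSrcAnalysisAtW L M β μ (klFlowFrameU L M β U μ (nScales β + 1)) J))
                        (klEffectiveAction L M β U μ (klFlowFrameU L M β U μ (nScales β + 1)) klE0 (nScales β + 1)))) 2
                      (fun i => (ed (X i)).2)
                  else 0)‖) ≤ δ L := by
  classical
  set J := nScales β with hJ
  -- the depth and the canonical deep source site
  set Rd : ℕ → ℕ := fun L => 2 * (J + 1) * r L + r L with hRd_def
  have hRdlim : Tendsto Rd atTop atTop := tendsto_atTop_mono (fun L => Nat.le_add_left _ _) hr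
  have hε : ∀ (M : ℕ) [NeZero M], 0 < imagTimeWeight β M := fun M _ => by
    have hM : (0 : ℝ) < M := Nat.cast_pos.2 (Nat.pos_of_ne_zero (NeZero.ne M))
    unfold imagTimeWeight; positivity
  -- the value at an instance: the door's quantity at the canonical structures and the canonical site
  obtain ⟨val, hval⟩ : ∃ val : (L b M : ℕ) → [NeZero L] → [NeZero (b * L)] → [NeZero M] → ℝ,
      ∀ (L b M : ℕ) [NeZero L] [NeZero (b * L)] [NeZero M], val L b M =
        2 * (imagTimeWeight β M)⁻¹ *
          (∑ X ∈ univ.filter (fun X : Fin 2 → SrcLabel (b * L) M J =>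
              X 0 = ((((⟨0, by have := NeZero.pos M; omega⟩ : ImagTimeIdx M), fun _ => ((Rd L : ℕ) : ZMod (b * L))),
                ((⟨0, sectorCount_pos _⟩, 0), 0)), 1) ∧ (X 1).2 = 1),
            ‖kernel ℂ (srcTrunc ℂ (fun Y : SrcLabel (b * L) M J => Y.2 = 1) 3 (srcSmooth (b * L) M J (klTowerD (b * L) M β U μ (klFlowFrameU (b * L) M β U μ (J + 1)) J))) 2 X -
              (if ∀ i, (klBlockEquivD L b M J (X i)).1 = (klBlockEquivD L b M J (X 0)).1 then
                kernel ℂ (srcTrunc ℂ (fun Y : SrcLabel L M J => Y.2 = 1) 3 (srcSmooth L M J (klTowerD L M β U μ (klFlowFrameU L M β U μ (J + 1)) J))) 2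
                  (fun i => (klBlockEquivD L b M J (X i)).2) else 0)‖) := ⟨_, fun _ _ _ _ _ _ => rfl⟩
  -- the value is below `2ε⁻¹ ×` the keyed defect of the read-outs at the canonical deep pin
  have hdeep : ∀ (L b : ℕ) [NeZero L] [NeZero (b * L)], ∀ j : Fin 2,
      Rd L ≤ (((fun _ => ((Rd L : ℕ) : ZMod (b * L))) : TorusSite 2 (b * L)) j).val % L ∧
        (((fun _ => ((Rd L : ℕ) : ZMod (b * L))) : TorusSite 2 (b * L)) j).val % L + Rd L < L := by
    intro L b _ _ j
    have hL : 0 < L := Nat.pos_of_ne_zero (NeZero.ne L)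
    have hb : 0 < b := Nat.pos_of_ne_zero fun h => NeZero.ne (b * L) (by rw [h, zero_mul])
    have hR := hRd L hL
    have hRL : Rd L < L := by simp only [hRd_def]; omega
    have hRbL : Rd L < b * L := hRL.trans_le (Nat.le_mul_of_pos_left L hb)
    have hv : (((Rd L : ℕ) : ZMod (b * L))).val = Rd L := by rw [ZMod.val_natCast, Nat.mod_eq_of_lt hRbL]
    simp only [hv, Nat.mod_eq_of_lt hRL]
    simp only [hRd_def] at hR ⊢
    omega
  have hval_le : ∀ (η : ℝ), 0 < η → ∀ᶠ L in atTop, ∀ (b M : ℕ) [NeZero L] [NeZero (b * L)] [NeZero M], Mth L b ≤ M → val L b M ≤ η := by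
    intro η hη
    filter_upwards [hend 2 (η / 2) (half_pos hη)] with L hL
    intro b M iL ibL iM hM
    rw [hval]
    have hεM := hε M
    set w₀ : SrcLabel (b * L) M J :=
      ((((⟨0, by have := NeZero.pos M; omega⟩ : ImagTimeIdx M), fun _ => ((Rd L : ℕ) : ZMod (b * L))), ((⟨0, sectorCount_pos _⟩, 0), 0)), 1) with hw₀
    have hw₀deep : ∀ i, 2 * (J + 1) * r L + r L ≤ (w₀.1.1.2 i).val % L ∧ (w₀.1.1.2 i).val % L + (2 * (J + 1) * r L + r L) < L :=
      fun i => hdeep L b i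
    have hD := hL b M hM 0 w₀ hw₀deep
    -- drop the source-copy filter (the values are already truncated)
    have hsub : univ.filter (fun X : Fin 2 → SrcLabel (b * L) M J => X 0 = w₀ ∧ (X 1).2 = 1) ⊆ univ.filter (fun X : Fin 2 → SrcLabel (b * L) M J => X 0 = w₀) :=
      fun X hX => by simp only [mem_filter, mem_univ, true_and] at hX ⊢; exact hX.1
    have h2 : 2 * (imagTimeWeight β M)⁻¹ * (imagTimeWeight β M * (η / 2)) = η := by field_simp [hεM.ne']
    calc 2 * (imagTimeWeight β M)⁻¹ * _ ≤ 2 * (imagTimeWeight β M)⁻¹ * (imagTimeWeight β M * (η / 2)) :=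
          mul_le_mul_of_nonneg_left ((sum_le_sum_of_subset_of_nonneg hsub fun _ _ _ => norm_nonneg _).trans hD) (by positivity)
      _ = η := h2
  have hval0 : ∀ (L b M : ℕ) [NeZero L] [NeZero (b * L)] [NeZero M], 0 ≤ val L b M := fun L b M _ _ _ => by
    rw [hval]; exact mul_nonneg (by have := hε M; positivity) (sum_nonneg fun _ _ => norm_nonneg _)
  -- the instance supremum of the truncated values
  let Inst : ℕ → Type := fun L => Σ' (b : ℕ) (M : ℕ) (_ : NeZero L) (_ : NeZero (b * L)) (_ : NeZero M), Mth L b ≤ M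
  obtain ⟨V, hV⟩ : ∃ V : (L : ℕ) → Inst L → ℝ, ∀ (L b M : ℕ) (iL : NeZero L) (ibL : NeZero (b * L)) (iM : NeZero M) (h : Mth L b ≤ M),
      V L ⟨b, M, iL, ibL, iM, h⟩ = min (val L b M) 1 :=
    ⟨fun L i => match i with | ⟨b, M, _, _, _, _⟩ => min (val L b M) 1, fun _ _ _ _ _ _ _ => rfl⟩
  have hV1 : ∀ L (i : Inst L), V L i ≤ 1 := fun L i => by obtain ⟨b, M, iL, ibL, iM, h⟩ := i; rw [hV]; exact min_le_right _ _
  have hV0 : ∀ L (i : Inst L), 0 ≤ V L i := fun L i => by obtain ⟨b, M, iL, ibL, iM, h⟩ := i; rw [hV]; exact le_min (hval0 L b M) zero_le_one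
  set δ : ℕ → ℝ := fun L => ⨆ i : Inst L, V L i with hδ
  have hδlim : Tendsto δ atTop (𝓝 0) := by
    refine tendsto_zero_of_forall_eventually_le (fun L => iSup_nonneg_inst (hV0 L)) fun η hη => ?_
    filter_upwards [hval_le η hη] with L hL
    refine iSup_le_of_forall_le' hη.le fun i => ?_
    obtain ⟨b, M, iL, ibL, iM, h⟩ := i
    rw [hV]
    exact (min_le_left _ _).trans (hL b M h)
  -- beyond `L₀` every value is `≤ 1`
  obtain ⟨L₁, hL₁⟩ := (hval_le 1 one_pos).exists_forall_of_atTop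
  refine ⟨L₁, δ, hδlim, Rd, hRdlim, fun L iL hL L'' iL'' b hbL => ?_⟩
  subst hbL
  refine ⟨Mth L b, fun M iM hM => ⟨J, klBlockEquiv L b M (sectorCount J), klBlockEquivD L b M J, klBlockEquiv_val L b M _, klBlockEquiv_snd L b M _,
    klBlockEquivD_apply L b M J, (((⟨0, by have := NeZero.pos M; omega⟩ : ImagTimeIdx M), fun _ => ((Rd L : ℕ) : ZMod (b * L)))), hdeep L b, ?_⟩⟩
  have hv := hval L b M
  have hle1 : val L b M ≤ 1 := hL₁ L hL b M hM
  have hVi : V L ⟨b, M, iL, iL'', iM, hM⟩ = val L b M := by rw [hV]; exact min_eq_left hle1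
  rw [← srcSmooth_klTowerD_eq hβ.ne' U μ (klFlowFrameU (b * L) M β U μ (J + 1)) J, ← srcSmooth_klTowerD_eq hβ.ne' U μ (klFlowFrameU L M β U μ (J + 1)) J]
  calc _ = val L b M := hv.symm
    _ = V L ⟨b, M, iL, iL'', iM, hM⟩ := hVi.symm
    _ ≤ δ L := le_iSup_inst (hV1 L) _

end Summit.HubbardSuperconductivity.HubbardSuperconductivity.Theorems.TwoVolumeSource

end
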